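import Summits.FinalStateConjecture.FinalStateConjecture.Statement
import Literature.Geometry.Lorentzian.CoordTensorCovariance
import Literature.Geometry.Lorentzian.MinkowskiCauchyDevelopment
import HarnessLib

/-!
# `CaptureSufficesTame` (stmt-FinalStateConjecture-17270), line `only-the-third-law-is-generic` (v4), stub G
# `stub_labelRigidityC0` AT THE MODEL POINT: the Minkowski development, reduction to "no C⁰-honest Kerr chart"

Stub G of skeleton v4 (C⁰ LABEL RIGIDITY: two honest C⁰ final-state decompositions of one censored maximal
development agree on "all holes are sub-extremal") is a research lemma in low-regularity Lorentzian rigidity. This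
file records, kernel-checked, what it is at the one maximal development the tree can name — Minkowski space over
the trivial datum (`Minkowski.vacuumCauchyDevelopment`, maximal modulo the Choquet-Bruhat–Geroch fact) — together
with the small structural facts an adversarial audit of the definitions rests on (lead a1 + stub worker, 2026-08-17;
`Cruxes/CaptureSufficesTame/LABEL-RIGIDITY-C0-a1.md`):

* (J2) `truncTimeSlab_boostedKerrBackground_nonempty_iff` — the truncated slab `{t* = τ, r ≤ R}` of the boosted
  Kerr background `(Λ, c, M, a)` is NONEMPTY iff `max r₊ 0 < R`; hence nonempty for every honest radius
  `R ≥ max r₊ 0 + 1` of `HasExhaustiveCharts` and for every `R > max r₊ 0` of the structure clause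
  `FinalStateDecomposition.tendsto_truncDeviationCk : ∀ i R, …` — the C⁰ convergence clause is never vacuous, for
  extremal labels too (`r₊(M, ±M) = M` by `simp [Kerr.rPlus]`).
* (J3) `enorm_deviation_le_truncDeviationCk`, `exists_forall_enorm_deviation_le(_chart)` — control of
  `truncDeviationCk … 0 R τ` for ALL late `τ : ℝ` is POINTWISE control of the full pulled-back 4-tensor
  `Ψ^* g − g₀` (all 16 components) on the FAT region `{T ≤ t*, r ≤ R}`. This all-real-`τ` quantifier is
  load-bearing: a single slab (or a sequence of slabs) of any Kerr label IS C⁰-mimicked in flat space by a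
  Lorentzian one-sided Nash–Kuiper corrugation with free transverse 1-jet
  (`Cruxes/GenericCensorshipCollarMargin/MisstatedByMimicry.md` §3, after Boukholkhal arXiv:2407.19333); only the
  foliation of a fat region is rigid.
* (J5) `finalStateDecomposition_minkowski_N_eq_zero`, `stub_labelRigidityC0_minkowski_of_noC0KerrChart` — at the
  Minkowski development every causal honesty clause of a parasitic hole chart is free (identity flat chart on
  `U₀ = E4`: `O = {x⁰ ≥ 0}`, covering by vertical segments), so G there is EXACTLY the concrete C⁰ rigidity
  statement NoC0KerrChart (hypothesis `h`, registered as the sub-goal `stub_noC0KerrChartIntoMinkowski`): no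
  boosted Kerr exterior `(Λ, c, M, a)`, `0 < M`, `|a| ≤ M`, carries a late chart into Minkowski space whose
  truncated C⁰ deviations tend to `0` for every radius. Given `h`, every final-state decomposition of Minkowski
  space (any region, any `Cᵏ`) has `N = 0`, whence the model-point instance of G's conclusion. NoC0KerrChart is
  TRUE on paper (LABEL-RIGIDITY-C0-a1.md: C⁰ limits of pull-backs of `η` by injective maps inherit the achronality
  of Minkowski null cones — Hausdorff limits of the pulled-back future null cones are achronal closed sets containing
  every null geodesic from the vertex past its cut point — while every Kerr exterior chunk `{r₊ < r < 5M}` contains a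
  NON-achronal null geodesic segment, one revolution of an equatorial circular photon orbit,
  `Kerr.exists_trappedNullGeodesic`; alternatively LABEL-RIGIDITY-C0-c3 (A): time-separation sandwich +
  Alexander–Bishop) and is the line's one Lean-attackable target without dynamics.
-/

-- the doubled `FinalStateConjecture.FinalStateConjecture` path component trips dupNamespace (as in the skeleton)
set_option linter.dupNamespace false

noncomputable section

open scoped Manifold ContDiff Topology ENNReal
open Set Function Filter

namespace Summit.FinalStateConjecture.FinalStateConjecture.Theorems.PhaseMixingCaptureCaptureSufficesTame

open Literature.Geometry.Lorentzian
open Summit.FinalStateConjecture (HasCompleteNullInfinity exteriorOf RaysStayInClosure HasExhaustiveCharts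
  IsFutureOriented)

/-! ## (J2) Truncated slabs of the boosted Kerr background are nonempty exactly for `R > max r₊ 0` -/

/-- **A rest-frame slab point with prescribed time and Kerr radius**: for `0 ≤ s` the point
`y = τ ∂₀ + √(a² + s²) ∂₁` (equatorial ring plane `x₃ = 0`) has Kerr–Schild time `y⁰ = τ` and Kerr radius
`r(y) = s` (Visser's quartic with `z = 0`: `r² = ρ² − a²`). [cite: arXiv07060622, (35)] -/
theorem exists_point_time_eq_radius_eq (τ a : ℝ) {s : ℝ} (hs : 0 ≤ s) :
    ∃ y : E4, y 0 = τ ∧ Kerr.radius a y = s := by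
  refine ⟨τ • EuclideanSpace.single (0 : Fin 4) (1 : ℝ) +
    Real.sqrt (a ^ 2 + s ^ 2) • EuclideanSpace.single (1 : Fin 4) (1 : ℝ), ?_, ?_⟩
  · simp
  · have happ : ∀ μ : Fin 4, (τ • EuclideanSpace.single (0 : Fin 4) (1 : ℝ) +
        Real.sqrt (a ^ 2 + s ^ 2) • EuclideanSpace.single (1 : Fin 4) (1 : ℝ)) μ =
        (if μ = 0 then τ else 0) + if μ = 1 then Real.sqrt (a ^ 2 + s ^ 2) else 0 := by
      intro μ
      simp only [PiLp.add_apply, PiLp.smul_apply, PiLp.single_apply, smul_eq_mul, mul_ite, mul_one,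
        mul_zero]
    have hρ : E4.spatialNorm (τ • EuclideanSpace.single (0 : Fin 4) (1 : ℝ) +
        Real.sqrt (a ^ 2 + s ^ 2) • EuclideanSpace.single (1 : Fin 4) (1 : ℝ)) ^ 2 = a ^ 2 + s ^ 2 := by
      rw [E4.spatialNorm_sq, happ, happ, happ]
      simp only [Fin.isValue, ↓reduceIte, Fin.reduceEq, one_ne_zero, zero_add]
      rw [Real.sq_sqrt (by positivity)]
      ring
    have h3 : (τ • EuclideanSpace.single (0 : Fin 4) (1 : ℝ) +
        Real.sqrt (a ^ 2 + s ^ 2) • EuclideanSpace.single (1 : Fin 4) (1 : ℝ)) 3 = 0 := by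
      rw [happ]; simp
    unfold Kerr.radius
    rw [hρ, h3]
    have h1 : a ^ 2 + s ^ 2 - a ^ 2 = s ^ 2 := by ring
    rw [h1]
    have h2 : (s ^ 2) ^ 2 + 4 * a ^ 2 * (0 : ℝ) ^ 2 = (s ^ 2) ^ 2 := by ring
    rw [h2, Real.sqrt_sq (by positivity)]
    have h4 : (s ^ 2 + s ^ 2) / 2 = s ^ 2 := by ring
    rw [h4, Real.sqrt_sq hs]

/-- The inverse Poincaré map undoes the motion: `Λ⁻¹((Λ y + c) − c) = y`. [folklore] -/
private theorem poincareInv_apply_motion (Λ : lorentzGroup) (c y : E4) :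
    poincareInv Λ c ((Λ : E4 ≃L[ℝ] E4) y + c) = y := by
  rw [poincareInv, add_sub_cancel_right, ContinuousLinearEquiv.symm_apply_apply]

/-- **The truncated slab `{t* = τ, r ≤ R}` of the boosted Kerr background `(Λ, c, M, a)` is nonempty iff
`max r₊ 0 < R`.** (`⇒`: a slab point has `max r₊ 0 < r ≤ R`; `⇐`: the moved slab point
`Λ y(τ, a, s) + c` with `s ∈ (max r₊ 0, R]`.) DHRT arXiv:2104.08222, §1 (near zones `{r ≤ R}`).
[cite: arXiv210408222, §1] -/
theorem truncTimeSlab_boostedKerrBackground_nonempty_iff (Λ : lorentzGroup) (c : E4) (M a R τ : ℝ) :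
    ((boostedKerrBackground Λ c M a).truncTimeSlab R τ).Nonempty ↔ max (Kerr.rPlus M a) 0 < R := by
  constructor
  · rintro ⟨x, hxt, hxR⟩
    have hx : poincareInv Λ c x.1 ∈ Kerr.exterior M a := x.2
    rw [Kerr.mem_exterior] at hx
    exact hx.trans_le hxR
  · intro hR
    have hs0 : 0 ≤ R := (le_max_right _ _).trans hR.le
    obtain ⟨y, hy0, hrad⟩ := exists_point_time_eq_radius_eq τ a hs0
    have hmem : (Λ : E4 ≃L[ℝ] E4) y + c ∈ boostedKerrExterior Λ c M a := by
      rw [mem_boostedKerrExterior, poincareInv_apply_motion, Kerr.mem_exterior, hrad]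
      exact hR
    refine ⟨⟨(Λ : E4 ≃L[ℝ] E4) y + c, hmem⟩, ?_, ?_⟩
    · show poincareInv Λ c ((Λ : E4 ≃L[ℝ] E4) y + c) 0 = τ
      rw [poincareInv_apply_motion, hy0]
    · show Kerr.radius a (poincareInv Λ c ((Λ : E4 ≃L[ℝ] E4) y + c)) ≤ R
      rw [poincareInv_apply_motion, hrad]

/-- Dually, the truncated slab is EMPTY iff `R ≤ max r₊ 0` — the only vacuous instances of the
structure clause `tendsto_truncDeviationCk : ∀ i R, …` (which also ranges over every `R > max r₊ 0`).
[cite: arXiv210408222, §1] -/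
theorem truncTimeSlab_boostedKerrBackground_eq_empty_iff (Λ : lorentzGroup) (c : E4) (M a R τ : ℝ) :
    (boostedKerrBackground Λ c M a).truncTimeSlab R τ = ∅ ↔ R ≤ max (Kerr.rPlus M a) 0 := by
  rw [← not_nonempty_iff_eq_empty, truncTimeSlab_boostedKerrBackground_nonempty_iff, not_lt]

/-- **No vacuous near zone under honest radii**: with `max r₊ 0 + 1 ≤ R` (the radius clause of
`HasExhaustiveCharts`) every truncated slab `{t*ᵢ = τ, rᵢ ≤ R}` is nonempty — for EVERY label
`0 < M`, `|a| ≤ M`, extremal ones included (`r₊ = M` there). [cite: arXiv210408222, §1] -/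
theorem truncTimeSlab_boostedKerrBackground_nonempty_of_honest (Λ : lorentzGroup) (c : E4) {M a R : ℝ}
    (hR : max (Kerr.rPlus M a) 0 + 1 ≤ R) (τ : ℝ) :
    ((boostedKerrBackground Λ c M a).truncTimeSlab R τ).Nonempty :=
  (truncTimeSlab_boostedKerrBackground_nonempty_iff Λ c M a R τ).2 (by linarith)

/-- In particular for an honest decomposition `d` with exhaustive radii `R`, every certified hole slab
is nonempty. [cite: arXiv210408222, §1] -/
theorem truncTimeSlab_background_nonempty_of_hasExhaustiveCharts {𝓢 : Spacetime.{0} 4} {O : Set 𝓢.carrier}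
    {k : ℕ} (d : FinalStateDecomposition 𝓢 O k) {R : Fin d.N → ℝ → ℝ}
    (hR : ∀ i τ, max (Kerr.rPlus (d.mass i) (d.spin i)) 0 + 1 ≤ R i τ) (i : Fin d.N) (τ : ℝ) :
    ((d.background i).truncTimeSlab (R i τ) τ).Nonempty :=
  truncTimeSlab_boostedKerrBackground_nonempty_of_honest _ _ (hR i τ) τ

/-! ## (J3) All-slab control is pointwise control of the full 4-tensor on the fat late region -/

/-- **Pointwise form of the near-zone deviation**: at every point `x` of the chart domain with `r(x) ≤ R`,
the full pulled-back deviation `(Ψ^* g − g₀)(x)` (a bilinear form on `E4`, all 16 components, transverse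
ones included) is bounded by the truncated `C⁰` deviation of the slab through `x`.
[cite: arXiv210408222, §1] -/
theorem enorm_deviation_le_truncDeviationCk (𝓢 : Spacetime.{0} 4) (B : ModelBackground)
    (Ψ : B.domain → 𝓢.carrier) (x : B.domain) {R : ℝ} (hx : B.radius x.1 ≤ R) :
    ‖𝓢.deviation B Ψ x‖ₑ ≤ 𝓢.truncDeviationCk B Ψ 0 R (B.time x.1) := by
  have hmem : x.1 ∈ Subtype.val '' B.truncTimeSlab R (B.time x.1) :=
    mem_image_of_mem _ (show x ∈ B.truncTimeSlab R (B.time x.1) from ⟨rfl, hx⟩)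
  have h := enorm_iteratedFDeriv_le_supCkENorm (m := 0) (k := 0) le_rfl hmem (𝓢.deviationExtend B Ψ)
  rw [← 𝓢.deviationExtend_coe B Ψ x]
  refine le_trans ?_ h
  rw [enorm_eq_nnnorm, enorm_eq_nnnorm, ENNReal.coe_le_coe, ← NNReal.coe_le_coe, coe_nnnorm, coe_nnnorm,
    norm_iteratedFDeriv_zero]

/-- **All late slabs ⇒ the fat region.** If the truncated `C⁰` deviation at radius `R` is eventually
`≤ ε` in chart time, then `‖(Ψ^* g − g₀)(x)‖ ≤ ε` at EVERY point of the fat region `{T ≤ t*(x), r(x) ≤ R}`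
for some `T` — an equidimensional (open-set) `C⁰`-approximate isometry condition, not a
hypersurface one. [cite: arXiv210408222, §1] -/
theorem exists_forall_enorm_deviation_le (𝓢 : Spacetime.{0} 4) (B : ModelBackground)
    (Ψ : B.domain → 𝓢.carrier) {R : ℝ} {ε : ℝ≥0∞}
    (h : ∀ᶠ τ in atTop, 𝓢.truncDeviationCk B Ψ 0 R τ ≤ ε) :
    ∃ T : ℝ, ∀ x : B.domain, T ≤ B.time x.1 → B.radius x.1 ≤ R → ‖𝓢.deviation B Ψ x‖ₑ ≤ ε := by
  obtain ⟨T, hT⟩ := eventually_atTop.1 h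
  exact ⟨T, fun x hxT hxR ↦ (enorm_deviation_le_truncDeviationCk 𝓢 B Ψ x hxR).trans (hT _ hxT)⟩

/-- The same for a hole chart of a final-state decomposition (in any `Cᵏ`, read in `C⁰`): near-zone
convergence forces, for every `R` and `ε > 0`, uniform `ε`-closeness of ALL components of
`(chart i)^* g` to boosted Kerr on a fat late region `{T ≤ t*ᵢ, rᵢ ≤ R}`. [cite: arXiv210408222, §1] -/
theorem exists_forall_enorm_deviation_le_chart {𝓢 : Spacetime.{0} 4} {O : Set 𝓢.carrier}
    {k : ℕ} (d : FinalStateDecomposition 𝓢 O k) (i : Fin d.N) (R : ℝ) {ε : ℝ≥0∞} (hε : 0 < ε) :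
    ∃ T : ℝ, ∀ x : (d.background i).domain, T ≤ (d.background i).time x.1 →
      (d.background i).radius x.1 ≤ R → ‖𝓢.deviation (d.background i) (d.chart i) x‖ₑ ≤ ε := by
  refine exists_forall_enorm_deviation_le 𝓢 (d.background i) (d.chart i) ?_
  have h0 : Tendsto (fun τ ↦ 𝓢.truncDeviationCk (d.background i) (d.chart i) 0 R τ) atTop (𝓝 0) :=
    tendsto_of_tendsto_of_tendsto_of_le_of_le tendsto_const_nhds (d.tendsto_truncDeviationCk i R)
      (fun _ ↦ zero_le) fun τ ↦ supCkENorm_mono_right _ (Nat.zero_le k) _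
  exact h0.eventually (ge_mem_nhds hε)

/-! ## (J5) The model point: at the Minkowski development G is EXACTLY "no `C⁰`-honest Kerr late chart into `ℝ⁴₁`"

With the identity flat chart on `U₀ = E4` every causal honesty clause of a parasitic `N ≥ 1` decomposition of
Minkowski space is free (`O = {x⁰ ≥ 0}` by `chronologicalPast_late`; covering by vertical segments;
`RaysStayInClosure`, complete `𝓘⁺` proved), so the whole weight of G there is carried by the metric clause.
Conversely — the direction recorded here — the concrete `C⁰` rigidity statement (hypothesis `h`, spelled out;
true on paper — LABEL-RIGIDITY-C0-a1.md / -c3.md (A) — with the time-shift bookkeeping of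
`TimeTranslateOmegaLimit.lean`) forces `N = 0` for EVERY final-state decomposition of Minkowski space in
every `Cᵏ`, hence the model-point instance of the stub's conclusion. -/

/-- An `IsLateChart` into a region is an `IsLateChart` into the whole spacetime. [cite: arXiv210408222, §1] -/
theorem isLateChart_univ_of {𝓢 : Spacetime.{0} 4} {B : ModelBackground} {𝒟 : Set 𝓢.carrier} {τ₀ : ℝ}
    {Ψ : B.domain → 𝓢.carrier} (h : 𝓢.IsLateChart B 𝒟 τ₀ Ψ) : 𝓢.IsLateChart B univ τ₀ Ψ :=
  ⟨h.contMDiff, h.isOpenEmbedding, subset_univ _⟩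

/-- **Model-point reduction.** If no boosted Kerr exterior `(Λ, c, M, a)`, `0 < M`, `|a| ≤ M`, carries a
late chart into Minkowski space whose truncated `C⁰` deviations tend to `0` for every radius, then every
final-state decomposition of Minkowski space (any region, any `Cᵏ`) has NO hole. [cite: arXiv210408222, §1] -/
theorem finalStateDecomposition_minkowski_N_eq_zero
    (h : ∀ (Λ : lorentzGroup) (c : E4) (M a τ₀ : ℝ), 0 < M → |a| ≤ M →
      ∀ Ψ : (boostedKerrBackground Λ c M a).domain → Minkowski.spacetime.carrier,
        Minkowski.spacetime.IsLateChart (boostedKerrBackground Λ c M a) univ τ₀ Ψ →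
        ¬ ∀ R : ℝ, Tendsto (fun τ ↦ Minkowski.spacetime.truncDeviationCk
            (boostedKerrBackground Λ c M a) Ψ 0 R τ) atTop (𝓝 0))
    {O : Set Minkowski.spacetime.carrier} {k : ℕ} (d : FinalStateDecomposition Minkowski.spacetime O k) :
    d.N = 0 := by
  by_contra hN
  obtain ⟨n, hn⟩ := Nat.exists_eq_succ_of_ne_zero hN
  set i : Fin d.N := ⟨0, by omega⟩ with hi
  refine h (d.motion i).1 (d.motion i).2 (d.mass i) (d.spin i) d.τ₀ (d.mass_pos i) (d.abs_spin_le_mass i)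
    (d.chart i) (isLateChart_univ_of (d.isLateChart i)) fun R ↦ ?_
  exact tendsto_of_tendsto_of_tendsto_of_le_of_le tendsto_const_nhds (d.tendsto_truncDeviationCk i R)
    (fun _ ↦ zero_le) fun τ ↦ supCkENorm_mono_right _ (Nat.zero_le k) _

/-- **Hence the model-point instance of the stub** (its conclusion for `𝒟 =` the Minkowski development of the
trivial datum, whatever the honest `d₁` and whatever the clauses of `d₂`): all holes of `d₂` are
sub-extremal because there are none. [cite: ChristodoulouKlainerman1993, Thm. 1.0.2] -/
theorem stub_labelRigidityC0_minkowski_of_noC0KerrChart :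
    (∀ (Λ : lorentzGroup) (c : E4) (M a τ₀ : ℝ), 0 < M → |a| ≤ M →
      ∀ Ψ : (boostedKerrBackground Λ c M a).domain → Minkowski.spacetime.carrier,
        Minkowski.spacetime.IsLateChart (boostedKerrBackground Λ c M a) univ τ₀ Ψ →
        ¬ ∀ R : ℝ, Tendsto (fun τ ↦ Minkowski.spacetime.truncDeviationCk
            (boostedKerrBackground Λ c M a) Ψ 0 R τ) atTop (𝓝 0)) →
    ∀ (O₂ : Set Minkowski.vacuumCauchyDevelopment.carrier)
      (d₂ : FinalStateDecomposition Minkowski.vacuumCauchyDevelopment.toSpacetime O₂ 0),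
      ∀ j, Kerr.IsSubextremal (d₂.mass j) (d₂.spin j) := by
  intro h O₂ d₂
  have hN : d₂.N = 0 := finalStateDecomposition_minkowski_N_eq_zero h d₂
  intro j
  exact (Fin.cast hN j).elim0

-- the concrete model-point rigidity statement (hypothesis `h` above) type-checks as a closed `Prop`:
example : Prop :=
  ∀ (Λ : lorentzGroup) (c : E4) (M a τ₀ : ℝ), 0 < M → |a| ≤ M →
    ∀ Ψ : (boostedKerrBackground Λ c M a).domain → Minkowski.spacetime.carrier,
      Minkowski.spacetime.IsLateChart (boostedKerrBackground Λ c M a) univ τ₀ Ψ →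
      ¬ ∀ R : ℝ, Tendsto (fun τ ↦ Minkowski.spacetime.truncDeviationCk
          (boostedKerrBackground Λ c M a) Ψ 0 R τ) atTop (𝓝 0)

/-! ## (J4) The flat-limit rigidity lemma in curvature form (statement only; it type-checks over tree vocabulary)

`C⁰`-LIMITS OF FLAT LORENTZIAN METRICS UNDER OPEN EMBEDDINGS INTO MINKOWSKI SPACE ARE FLAT
(coordinate form; LABEL-RIGIDITY-C0-c3 (A): sandwich of time separations, causal convexity of
intrinsically globally hyperbolic open subsets of `ℝ⁴₁`, exact Minkowski triangles, Alexander–Bishop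
`K = 0` both ways). Nothing is asserted here. -/

-- the research lemma G reduces to at the model point (Minkowski development), as ONE signature:
example : Prop :=
  ∀ (W : Set E4) (G : E4 → E4 →L[ℝ] E4 →L[ℝ] ℝ) (φ : ℕ → E4 → E4),
    MetricCoord.IsMetricOn G W →
    (∀ x ∈ W, (∃ v : E4, G x v v < 0) ∧
      ∀ v w : E4, G x v v < 0 → G x v w = 0 → w ≠ 0 → 0 < G x w w) →
    (∀ n, ContDiffOn ℝ ∞ (φ n) W) → (∀ n, Set.InjOn (φ n) W) →
    (∀ ε > (0 : ℝ), ∀ᶠ n in atTop, ∀ x ∈ W,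
      ‖MetricCoord.pullMetric (fun _ : E4 ↦ Minkowski.bilin) (φ n) x - G x‖ ≤ ε) →
    ∀ x ∈ W, ∀ X Y : E4, MetricCoord.riemAt G x X Y = 0

end Summit.FinalStateConjecture.FinalStateConjecture.Theorems.PhaseMixingCaptureCaptureSufficesTame

end
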